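import Summits.BirchSwinnertonDyer.BirchSwinnertonDyer.Theorems.KolyvaginRoadThreePTMilneOfCardSq
import Summits.BirchSwinnertonDyer.BirchSwinnertonDyer.Theorems.KolyvaginRoadThreePTSelmerComplementAtOfMiddleExact
import HarnessLib

/-!
# Milne *ADT* I Thm. 4.10(b) for `E[p]`, `p` an odd prime, over every number field — unconditionally

Route `KolyvaginRoadThree`, crux `ZhangSharpFrameAtThreeHL` (stmt-BirchSwinnertonDyer-19574): the PT road's
end state SPECIALISED to the module the METHOD line consumes, `E[p] = W.torsionGaloisModule p` (with
`W := W₀.baseChange K`, `p = 3` for the line): `#E[p] = p²` (`natCard_geomTorsion`) and `p · E[p] = 0`, so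
`middleExact_canonical_of_card_eq_sq` applies.  This is the hypothesis shape `hE(E[3], S)` (Milne I 4.10(b)
for THE local invariant maps, every finite `S` off which `p` and `E[p]` are unramified) against which
the ACCEL seat `bsd-stepL-koly3b` re-derives the S2-ENGINE chain (step (R)); with it the line's stub
`stub_poitouTateSelmerStructureDualityIQ` is no longer needed for `E[3]`.  Composed with `bsd-stepL-koly3b`'s
`PTAt.selmerComplementAt_canonical_of_middleExact` (both Howard inclusions at ONE module from Milne's middle
exactness at that module): **Poitou–Tate duality for Selmer structures (`SelmerComplement`) AT `E[p]`,
unconditionally** (`selmerComplementAt_canonical_torsionGaloisModule`) — the exact instance the S2-ENGINE chain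
consumes.  THEOREMS only; no named fact; no case of BSD.

References: [MilneADT2006] I Thm. 4.10(b); [SilvermanAEC2009] Cor. III.6.4(b).
-/

noncomputable section

open Function NumberField IsDedekindDomain Field
open scoped NumberField

set_option linter.dupNamespace false
set_option autoImplicit false

namespace Summit.BirchSwinnertonDyer.BirchSwinnertonDyer.Theorems.KolyvaginRoadThreePT

open Literature.NumberTheory.GaloisRepresentations Literature.NumberTheory.GaloisCohomology
open Literature.NumberTheory.GaloisRepresentations.DiscreteGaloisModule (unramifiedSubgroup localTatePairingZMod
  SelmerStructure)
open Literature.NumberTheory.EllipticCurves WeierstrassCurve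

/-- **Milne I Thm. 4.10(b) `Ker γ¹ ⊆ Im β¹` for `E[p]` over a number field `K`, `p` an odd prime, THE local
invariant maps, every finite set of places `S` off which `p` and `E[p]` are unramified** — unconditionally
(`middleExact_canonical_of_card_eq_sq` with `#E[p] = p²`, `p · E[p] = 0`).  The `Finite` instance binder is
satisfied by `finite_geomTorsion_of_neZero` (any instance will do). [cite: MilneADT2006, Ch. I, Thm. 4.10(b)] -/
theorem middleExact_canonical_torsionGaloisModule {K : Type} [Field K] [NumberField K] (W : WeierstrassCurve K)
    [W.IsElliptic] {p : ℕ} [hp : Fact p.Prime] (hodd : Odd p) [Finite (geomTorsion W (p : ℤ))]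
    {S : Finset (Place K)}
    (hS : ∀ v : HeightOneSpectrum (𝓞 K), (Sum.inr v : Place K) ∉ S →
      ((p : ℕ) : 𝓞 K) ∉ v.asIdeal ∧ GaloisRep.IsUnramifiedAt v (W.torsionGaloisModule (p : ℤ)))
    (t : Π v : Place K, galoisCohomology ((W.torsionGaloisModule (p : ℤ)).toLocal v) 1)
    (horth : ∀ y : galoisCohomology ((W.torsionGaloisModule (p : ℤ)).tateDual p) 1,
      (∀ v : HeightOneSpectrum (𝓞 K), (Sum.inr v : Place K) ∉ S →
        galoisCohomology.localization ((W.torsionGaloisModule (p : ℤ)).tateDual p) (Sum.inr v) 1 y ∈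
          unramifiedSubgroup (GaloisRep.toLocal v ((W.torsionGaloisModule (p : ℤ)).tateDual p)) 1) →
      ∑ v ∈ S, localTatePairingZMod (W.torsionGaloisModule (p : ℤ)) p v (LocalInvariants.canonical K p v) (t v)
        (galoisCohomology.localization ((W.torsionGaloisModule (p : ℤ)).tateDual p) v 1 y) = 0) :
    ∃ x : galoisCohomology (W.torsionGaloisModule (p : ℤ)) 1,
      (∀ v : HeightOneSpectrum (𝓞 K), (Sum.inr v : Place K) ∉ S →
        galoisCohomology.localization (W.torsionGaloisModule (p : ℤ)) (Sum.inr v) 1 x ∈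
          unramifiedSubgroup (GaloisRep.toLocal v (W.torsionGaloisModule (p : ℤ))) 1) ∧
      ∀ v ∈ S, galoisCohomology.localization (W.torsionGaloisModule (p : ℤ)) v 1 x = t v :=
  middleExact_canonical_of_card_eq_sq hodd (W.torsionGaloisModule (p : ℤ))
    (fun P => Subtype.ext (by
      have h := (mem_geomTorsion_iff W (p : ℤ) (P : geomPoints W)).mp P.2
      rw [natCast_zsmul] at h
      exact h))
    (by
      haveI : NeZero (p : K) := ⟨Nat.cast_ne_zero.mpr hp.out.ne_zero⟩
      exact Literature.NumberTheory.EllipticCurves.natCard_geomTorsion W p) hS t horth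


/-- **Poitou–Tate duality for Selmer structures AT `E[p]` (Howard 2004 Thm. 2.1.11, both inclusions
"annihilator ⊆ image", THE invariant maps `LocalInvariants.canonical K p`), unconditionally**: for every
finite `S` off which `p` and `E[p]` are unramified and every pair of Selmer structures `𝓕 ≤ 𝓖` on `E[p]`
unramified outside `S`.  `middleExact_canonical_torsionGaloisModule` fed into `bsd-stepL-koly3b`'s
`PTAt.selmerComplementAt_canonical_of_middleExact`.  This is the `SelmerComplement`-body AT `E[p]` — the one
place where the ∀-module named fact `poitouTate_selmerStructure_duality K` entered the S2-ENGINE chain of crux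
19574. [cite: Howard2004HeegnerKolyvagin, Thm. 2.1.11 (arXiv:1202.6340 p. 6)] [cite: MilneADT2006, Ch. I, Thm. 4.10] -/
theorem selmerComplementAt_canonical_torsionGaloisModule {K : Type} [Field K] [NumberField K]
    (W : WeierstrassCurve K) [W.IsElliptic] {p : ℕ} [hp : Fact p.Prime] (hodd : Odd p)
    [Finite (geomTorsion W (p : ℤ))] :
    haveI : NeZero p := ⟨hp.out.ne_zero⟩
    ∀ (S : Finset (Place K)),
      (∀ v : HeightOneSpectrum (𝓞 K), (Sum.inr v : Place K) ∉ S →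
        ((p : ℕ) : 𝓞 K) ∉ v.asIdeal ∧ GaloisRep.IsUnramifiedAt v (W.torsionGaloisModule (p : ℤ))) →
    ∀ (𝓕 𝓖 : SelmerStructure (W.torsionGaloisModule (p : ℤ))), 𝓕 ≤ 𝓖 → 𝓕.IsUnramifiedOutside S →
      𝓖.IsUnramifiedOutside S →
      (∀ t : Π v : Place K, galoisCohomology ((W.torsionGaloisModule (p : ℤ)).toLocal v) 1, (∀ v ∈ S, t v ∈ 𝓖 v) →
        (∀ y ∈ ((LocalInvariants.canonical K p).dualSelmerStructure (W.torsionGaloisModule (p : ℤ)) 𝓕).selmerGroup,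
          ∑ v ∈ S, localTatePairingZMod (W.torsionGaloisModule (p : ℤ)) p v (LocalInvariants.canonical K p v) (t v)
            (galoisCohomology.localization ((W.torsionGaloisModule (p : ℤ)).tateDual p) v 1 y) = 0) →
        ∃ x ∈ 𝓖.selmerGroup, ∀ v ∈ S,
          galoisCohomology.localization (W.torsionGaloisModule (p : ℤ)) v 1 x - t v ∈ 𝓕 v) ∧
      (∀ u : Π v : Place K, galoisCohomology (((W.torsionGaloisModule (p : ℤ)).tateDual p).toLocal v) 1,
        (∀ v ∈ S, u v ∈ (LocalInvariants.canonical K p).dualSelmerStructure (W.torsionGaloisModule (p : ℤ)) 𝓕 v) →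
        (∀ x ∈ 𝓖.selmerGroup,
          ∑ v ∈ S, localTatePairingZMod (W.torsionGaloisModule (p : ℤ)) p v (LocalInvariants.canonical K p v)
            (galoisCohomology.localization (W.torsionGaloisModule (p : ℤ)) v 1 x) (u v) = 0) →
        ∃ y ∈ ((LocalInvariants.canonical K p).dualSelmerStructure (W.torsionGaloisModule (p : ℤ)) 𝓕).selmerGroup,
          ∀ v ∈ S, galoisCohomology.localization ((W.torsionGaloisModule (p : ℤ)).tateDual p) v 1 y - u v ∈
            (LocalInvariants.canonical K p).dualSelmerStructure (W.torsionGaloisModule (p : ℤ)) 𝓖 v) := by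
  haveI : NeZero p := ⟨hp.out.ne_zero⟩
  exact Summit.BirchSwinnertonDyer.Rank1Residual.X11b.Three.Koly.PTAt.selmerComplementAt_canonical_of_middleExact
    p hp.out.isPrimePow (W.torsionGaloisModule (p : ℤ))
    (fun P => Subtype.ext (by
      have h := (mem_geomTorsion_iff W (p : ℤ) (P : geomPoints W)).mp P.2
      rw [natCast_zsmul] at h
      exact h))
    (fun S _ hS t horth => middleExact_canonical_torsionGaloisModule W hodd hS t horth)

end Summit.BirchSwinnertonDyer.BirchSwinnertonDyer.Theorems.KolyvaginRoadThreePT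

end
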